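import Mathlib

/-!
# `DivisionGap.PerMultiplesHard` (stmt-ValiantsHypothesis-5068), line `uncharged-face-walk`:
stub `stub_sharpChoose` — the entropy-sharp binomial lower bound on the balanced window

For `n < 3k` and `3k ≤ 2n` (i.e. `⌊n/3⌋ < k ≤ 2n/3`):
`3 ^ n ≤ (n + 1) * C(n, k) * 2 ^ (n - ⌊n/3⌋)`, i.e. `C(n, k) ≥ 3^n / ((n+1) 2^{n - ⌊n/3⌋})`.

Proof (elementary, Mathlib only).  With `t j = C(n, j) * 2 ^ (n - j)`:
* `3 ^ n = (1 + 2) ^ n = Σ_{j ≤ n} t j` (`add_pow`);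
* `t (j+1) * (2 (j+1)) = t j * (n - j)` (`Nat.choose_succ_right_eq`), so `t` increases while
  `3j + 2 ≤ n` and is non-increasing afterwards; hence `t j ≤ t ⌊n/3⌋` for every `j`
  (`3 ⌊n/3⌋ ≤ n ≤ 3 ⌊n/3⌋ + 2`);
* so `3 ^ n ≤ (n + 1) * t ⌊n/3⌋` (`Finset.sum_le_card_nsmul`);
* finally `C(n, ⌊n/3⌋) ≤ C(n, k)` on the window: binomials increase up to the middle
  (`Nat.choose_le_succ_of_lt_half_left`), combined with `Nat.choose_symm` when `k > n/2`
  (then `⌊n/3⌋ ≤ n - k ≤ n/2`).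
-/

-- `Summit.ValiantsHypothesis.ValiantsHypothesis.…` is the tree's mandated layout (Sub = Summit).
set_option linter.dupNamespace false

namespace Summit.ValiantsHypothesis.ValiantsHypothesis.Theorems.DivisionGap.PerMultiplesHard.SharpChoose

open Finset

/-- The binomial expansion of `3 ^ n = (1 + 2) ^ n`: `3 ^ n = Σ_{j ≤ n} C(n, j) 2 ^ (n - j)`. -/
theorem three_pow_eq_sum (n : ℕ) :
    3 ^ n = ∑ j ∈ range (n + 1), n.choose j * 2 ^ (n - j) := by
  have h : (3 : ℕ) ^ n = (1 + 2) ^ n := by norm_num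
  rw [h, add_pow]
  refine sum_congr rfl fun j _ => ?_
  rw [one_pow, one_mul, mul_comm, Nat.cast_id]

/-- One-step ratio of the terms `t j = C(n, j) 2 ^ (n - j)`:
`t (j+1) * (2 (j+1)) = t j * (n - j)` for `j + 1 ≤ n`. -/
theorem term_succ_mul (n j : ℕ) (hj : j + 1 ≤ n) :
    n.choose (j + 1) * 2 ^ (n - (j + 1)) * (2 * (j + 1)) =
      n.choose j * 2 ^ (n - j) * (n - j) := by
  have h1 : n.choose (j + 1) * (j + 1) = n.choose j * (n - j) := Nat.choose_succ_right_eq n j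
  have h2 : 2 ^ (n - j) = 2 ^ (n - (j + 1)) * 2 := by
    rw [← pow_succ]
    congr 1
    omega
  rw [h2]
  calc n.choose (j + 1) * 2 ^ (n - (j + 1)) * (2 * (j + 1))
      = n.choose (j + 1) * (j + 1) * (2 ^ (n - (j + 1)) * 2) := by ring
    _ = n.choose j * (n - j) * (2 ^ (n - (j + 1)) * 2) := by rw [h1]
    _ = n.choose j * (2 ^ (n - (j + 1)) * 2) * (n - j) := by ring

/-- The terms increase while `3j + 2 ≤ n`: `t j ≤ t (j+1)`. -/
theorem term_le_succ (n j : ℕ) (hj : 3 * j + 2 ≤ n) :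
    n.choose j * 2 ^ (n - j) ≤ n.choose (j + 1) * 2 ^ (n - (j + 1)) := by
  have hpos : 0 < 2 * (j + 1) := by omega
  refine Nat.le_of_mul_le_mul_right ?_ hpos
  rw [term_succ_mul n j (by omega)]
  exact Nat.mul_le_mul_left _ (by omega)

/-- The terms are non-increasing once `n ≤ 3j + 2`: `t (j+1) ≤ t j`. -/
theorem succ_le_term (n j : ℕ) (hj : n ≤ 3 * j + 2) :
    n.choose (j + 1) * 2 ^ (n - (j + 1)) ≤ n.choose j * 2 ^ (n - j) := by
  rcases Nat.lt_or_ge n (j + 1) with h | h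
  · rw [Nat.choose_eq_zero_of_lt h, zero_mul]
    exact Nat.zero_le _
  · have hpos : 0 < 2 * (j + 1) := by omega
    refine Nat.le_of_mul_le_mul_right ?_ hpos
    rw [term_succ_mul n j h]
    exact Nat.mul_le_mul_left _ (by omega)

/-- Every term is at most the term at `j = ⌊n/3⌋`: `t j ≤ t ⌊n/3⌋`. -/
theorem term_le_third (n j : ℕ) :
    n.choose j * 2 ^ (n - j) ≤ n.choose (n / 3) * 2 ^ (n - n / 3) := by
  rcases le_or_gt j (n / 3) with hj | hj
  · -- increasing chain from `j` up to `n / 3`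
    have key : ∀ d : ℕ, j + d ≤ n / 3 →
        n.choose j * 2 ^ (n - j) ≤ n.choose (j + d) * 2 ^ (n - (j + d)) := by
      intro d
      induction d with
      | zero => intro; simp
      | succ d ih =>
        intro hd
        exact (ih (by omega)).trans (term_le_succ n (j + d) (by omega))
    have h := key (n / 3 - j) (by omega)
    rwa [Nat.add_sub_of_le hj] at h
  · -- non-increasing chain from `n / 3` up to `j`
    have key : ∀ d : ℕ,
        n.choose (n / 3 + d) * 2 ^ (n - (n / 3 + d)) ≤ n.choose (n / 3) * 2 ^ (n - n / 3) := by
      intro d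
      induction d with
      | zero => simp
      | succ d ih => exact (succ_le_term n (n / 3 + d) (by omega)).trans ih
    have h := key (j - n / 3)
    rwa [Nat.add_sub_of_le hj.le] at h

/-- Averaging: `3 ^ n ≤ (n + 1) * (C(n, ⌊n/3⌋) * 2 ^ (n - ⌊n/3⌋))`. -/
theorem three_pow_le (n : ℕ) :
    3 ^ n ≤ (n + 1) * (n.choose (n / 3) * 2 ^ (n - n / 3)) := by
  rw [three_pow_eq_sum]
  have h := sum_le_card_nsmul (range (n + 1)) (fun j => n.choose j * 2 ^ (n - j))
    (n.choose (n / 3) * 2 ^ (n - n / 3)) fun j _ => term_le_third n j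
  rwa [card_range, smul_eq_mul] at h

/-- Binomial coefficients are non-decreasing on `[0, n/2]`. -/
theorem choose_mono_left_half (n a b : ℕ) (hab : a ≤ b) (hb : b ≤ n / 2) :
    n.choose a ≤ n.choose b := by
  induction b, hab using Nat.le_induction with
  | base => exact le_rfl
  | succ k hk ih => exact (ih (by omega)).trans (Nat.choose_le_succ_of_lt_half_left (by omega))

/-- On the window `⌊n/3⌋ < k ≤ 2n/3`: `C(n, ⌊n/3⌋) ≤ C(n, k)`. -/
theorem choose_third_le (n k : ℕ) (h1 : n < 3 * k) (h2 : 3 * k ≤ 2 * n) :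
    n.choose (n / 3) ≤ n.choose k := by
  rcases le_or_gt k (n / 2) with hk | hk
  · exact choose_mono_left_half n (n / 3) k (by omega) hk
  · rw [← Nat.choose_symm (show k ≤ n by omega)]
    exact choose_mono_left_half n (n / 3) (n - k) (by omega) (by omega)

/-- **Registered stub `stub_sharpChoose`.**  On the balanced window `n < 3k`, `3k ≤ 2n`:
`3 ^ n ≤ (n + 1) * C(n, k) * 2 ^ (n - ⌊n/3⌋)` (`/` is `ℕ`-division). -/
theorem stub_sharpChoose : ∀ n k : ℕ, n < 3 * k → 3 * k ≤ 2 * n →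
    3 ^ n ≤ (n + 1) * n.choose k * 2 ^ (n - n / 3) := by
  intro n k h1 h2
  calc 3 ^ n ≤ (n + 1) * (n.choose (n / 3) * 2 ^ (n - n / 3)) := three_pow_le n
    _ ≤ (n + 1) * (n.choose k * 2 ^ (n - n / 3)) :=
      Nat.mul_le_mul_left _ (Nat.mul_le_mul_right _ (choose_third_le n k h1 h2))
    _ = (n + 1) * n.choose k * 2 ^ (n - n / 3) := (mul_assoc _ _ _).symm

end Summit.ValiantsHypothesis.ValiantsHypothesis.Theorems.DivisionGap.PerMultiplesHard.SharpChoose
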